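import Summits.Ventures.Crystal3D.Theorems.StickyWulffConstantCoaxialWallLawPayerFamilyEndsExcl
import Summits.Ventures.Crystal3D.Theorems.StickyWulffConstantCoaxialWallLawPayerPairCount
import Summits.Ventures.Crystal3D.Theorems.StickyWulffConstantCoaxialWallLawEndUniqueMulti
import HarnessLib

/-!
# End accounting, census-free, multi-source II′: all root families share the capacity — certified-state top exclusion

HONEST FRAMING. Part of the venture `Summits/Ventures/Crystal3D` (cell `crystal3d-full`), helper for the crux
`CoaxialWallLaw` (stmt-Ventures-19481) of `route-Ventures-StickyWulffConstant`, REGISTERED line `WallLedgerF`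
(planner cf-p1), open stub `stub_coaxialTwoSlabAdhesion` (general fillings).  Rung credit only; F-C1 not moved.
Brick (B3c′) of memo HOME/wall-19481-p2/F-MULTISOURCE.md (19481-p2 g4): the text of
`word_sources_le_lists_stateInv_payers_multiRT` (`…PayerInstanceMulti`) on top of `word_family_endPairs_excl`
(`…PayerFamilyEndsExcl`): the top exclusion is required only in the certified-state form «an invariant state with an
occupied slot triangle never sits on a top-sample ball with a full top-frame shell», which the IN-PLANE twin families
discharge by `word_noTop_of_inner_zero` (no well-formed in-plane word carries a triangle of the mirror frame) with the
trivial invariant.  Conclusion unchanged: `Σ_{r ∈ RT} #sources_r ≤ 78·#PAY + #RT·(220·#rim_top + 220·#rim_bottom)`,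
end pairs of different roots disjoint by LEMMA X (`…EndUniqueMulti`), capacity `card_endPairs_le_payers`.

WHAT THIS IS NOT: not the stub; the twin/translation cells are the next bricks; F-C1 not moved.
-/
noncomputable section

namespace Summit.Ventures.Crystal3D.Theorems

open Summit.Ventures.Crystal3D Finset
open Literature.MathematicalPhysics.StatisticalMechanics (fccStacking)
open scoped InnerProductSpace

section Multi

variable {X : Finset (EuclideanSpace ℝ (Fin 3))}
  {F : List (EuclideanSpace ℝ (Fin 3)) → (EuclideanSpace ℝ (Fin 3) ≃ₗᵢ[ℝ] EuclideanSpace ℝ (Fin 3))}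
  {u : EuclideanSpace ℝ (Fin 3) → List (EuclideanSpace ℝ (Fin 3)) → EuclideanSpace ℝ (Fin 3)}
  {WF : EuclideanSpace ℝ (Fin 3) → List (EuclideanSpace ℝ (Fin 3)) → Prop}
  {next : List (EuclideanSpace ℝ (Fin 3)) → EuclideanSpace ℝ (Fin 3) → List (EuclideanSpace ℝ (Fin 3))}
  {P₁ P' P₂ : Finset (EuclideanSpace ℝ (Fin 3))} {t₁ t₂ : EuclideanSpace ℝ (Fin 3)} {R₀ h ρ : ℝ}

open scoped Classical in
/-- **The multi-root census-free count with certified-state top exclusion.**  See the module docstring. -/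
theorem word_sources_le_lists_payers_multiExcl {δ : ℝ} (hg : KissingGap δ) (hc : KissingClassification δ)
    (hX : ∀ p ∈ X, ∀ q ∈ X, p ≠ q → 1 ≤ dist p q)
    (hFc : ∀ μ κ, F (μ :: κ) = ((ℝ ∙ μ)ᗮ.reflection).trans (F κ))
    (RT : Finset (EuclideanSpace ℝ (Fin 3))) (hRT : ∀ r ∈ RT, r ∈ fccSlots)
    (hu0 : ∀ r ∈ RT, u r [] = r) (huc : ∀ r ∈ RT, ∀ μ κ, u r (μ :: κ) = -u r κ)
    (hWF0 : ∀ r ∈ RT, WF r [])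
    (hWFc : ∀ r ∈ RT, ∀ μ κ, WF r (μ :: κ) ↔ (WF r κ ∧ ‖μ‖ = 1 ∧
      (∀ w ∈ fccSlots, ⟪w, μ⟫_ℝ = 0 ∨ ⟪w, μ⟫_ℝ = Real.sqrt (2 / 3) ∨ ⟪w, μ⟫_ℝ = -Real.sqrt (2 / 3)) ∧
      ⟪u r κ, μ⟫_ℝ = Real.sqrt (2 / 3) ∧ ∀ μ' κ', κ = μ' :: κ' → μ' ≠ -μ))
    (hnext_pop : ∀ μ κ' (m : EuclideanSpace ℝ (Fin 3)), (F (μ :: κ')).symm m = -μ → next (μ :: κ') m = κ')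
    (hnext_push : ∀ κ (m : EuclideanSpace ℝ (Fin 3)), (∀ μ κ', κ = μ :: κ' → (F κ).symm m ≠ -μ) →
      next κ m = (F κ).symm m :: κ)
    -- the top grain's frame and the shared state invariant
    (G₂ : EuclideanSpace ℝ (Fin 3) ≃ₗᵢ[ℝ] EuclideanSpace ℝ (Fin 3))
    {P : EuclideanSpace ℝ (Fin 3) × List (EuclideanSpace ℝ (Fin 3)) → Prop}
    (hPfull : ∀ r ∈ RT, ∀ (b : EuclideanSpace ℝ (Fin 3)) (κ : List (EuclideanSpace ℝ (Fin 3))), WF r κ →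
      P (b, κ) → P (b + F κ (u r κ), κ))
    (hPcross : ∀ r ∈ RT, ∀ (b : EuclideanSpace ℝ (Fin 3)) (κ : List (EuclideanSpace ℝ (Fin 3))) (m : EuclideanSpace ℝ (Fin 3)),
      WF r κ → WF r (next κ m) → P (b, κ) → P (b + F (next κ m) (u r (next κ m)), next κ m))
    (hPexcl0 : ∀ r ∈ RT, ∀ (b : EuclideanSpace ℝ (Fin 3)) (κ : List (EuclideanSpace ℝ (Fin 3))), WF r κ → P (b, κ) →
      b ∈ P₂ → (∀ w ∈ fccSlots, b + G₂ w ∈ X) →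
      (∃ a ∈ fccSlots, ∃ a' ∈ fccSlots, ∃ a'' ∈ fccSlots,
        ⟪a, a'⟫_ℝ = 1 / 2 ∧ ⟪a, a''⟫_ℝ = 1 / 2 ∧ ⟪a', a''⟫_ℝ = 1 / 2 ∧
        b + F κ a ∈ X ∧ b + F κ a' ∈ X ∧ b + F κ a'' ∈ X) → False)
    (hup : ∀ r ∈ RT, 0 < (F [] r) 2)
    -- the cell
    (hR₀ : 3 ≤ R₀) (hρ : R₀ ≤ ρ)
    (hcell : ∀ p ∈ X, -(2 * R₀) ≤ p 2 ∧ p 2 ≤ h + 2 * R₀ ∧ p 0 ^ 2 + p 1 ^ 2 ≤ ρ ^ 2)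
    (hP₁X : P₁ ⊆ X) (hP₂X : P₂ ⊆ X)
    (hP₁ : ∀ p, p ∈ P₁ ↔ (p ∈ (fun q => F [] q + t₁) '' fccStacking 1 (Real.sqrt (2 / 3)) ∧
      -(2 * R₀) ≤ p 2 ∧ p 2 ≤ -R₀ ∧ p 0 ^ 2 + p 1 ^ 2 ≤ ρ ^ 2))
    (hP' : ∀ p, p ∈ P' ↔ (p ∈ (fun q => F [] q + t₁) '' fccStacking 1 (Real.sqrt (2 / 3)) ∧
      -(2 * R₀) + 1 ≤ p 2 ∧ p 2 ≤ -R₀ - 1 ∧ p 0 ^ 2 + p 1 ^ 2 ≤ (ρ - 1) ^ 2))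
    (hP'full : ∀ p ∈ P', ∀ w ∈ fccSlots, p + F [] w ∈ X)
    (hPsrc : ∀ r ∈ RT, ∀ p ∈ P', P (p + F [] r, []))
    (hP₂ : ∀ p, p ∈ P₂ ↔ (p ∈ (fun q => G₂ q + t₂) '' fccStacking 1 (Real.sqrt (2 / 3)) ∧
      h + R₀ ≤ p 2 ∧ p 2 ≤ h + 2 * R₀ ∧ p 0 ^ 2 + p 1 ^ 2 ≤ ρ ^ 2)) :
    ∑ r ∈ RT, (P'.filter fun p => (∀ w ∈ fccSlots, p + F [] w ∈ X) ∧
        -R₀ - 1 < (p + F [] r) 2 ∧ (p + F [] r) 2 < h + R₀ + 1).card ≤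
      78 * (X.filter fun z => (X.filter fun q => dist z q = 1).card ≤ 11 ∧
          -R₀ - 1 - 1 ≤ z 2 ∧ z 2 ≤ h + R₀ + 1 + 1).card +
      RT.card *
        (220 * (X.filter fun s => h + R₀ + 1 ≤ s 2 ∧ s 2 ≤ h + R₀ + 1 + 1 ∧ (ρ - 2) ^ 2 < s 0 ^ 2 + s 1 ^ 2).card +
         220 * (X.filter fun s => -R₀ - 1 - 1 ≤ s 2 ∧ s 2 < -R₀ - 1 ∧ (ρ - 1) ^ 2 < s 0 ^ 2 + s 1 ^ 2).card) := by
  set RIM : ℕ :=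
    220 * (X.filter fun s => h + R₀ + 1 ≤ s 2 ∧ s 2 ≤ h + R₀ + 1 + 1 ∧ (ρ - 2) ^ 2 < s 0 ^ 2 + s 1 ^ 2).card +
      220 * (X.filter fun s => -R₀ - 1 - 1 ≤ s 2 ∧ s 2 < -R₀ - 1 ∧ (ρ - 1) ^ 2 < s 0 ^ 2 + s 1 ^ 2).card with hRIM
  -- the per-family end pairs
  have hfam : ∀ r ∈ RT, ∃ T : Finset (EuclideanSpace ℝ (Fin 3) × EuclideanSpace ℝ (Fin 3)),
      (P'.filter fun p => (∀ w ∈ fccSlots, p + F [] w ∈ X) ∧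
          -R₀ - 1 < (p + F [] r) 2 ∧ (p + F [] r) 2 < h + R₀ + 1).card ≤ T.card + RIM ∧
      (∀ bq ∈ T, bq.1 ∈ X ∧ bq.2 ∈ X ∧ dist bq.1 bq.2 = 1 ∧ -R₀ - 1 ≤ bq.1 2 ∧ bq.1 2 < h + R₀ + 1) ∧
      (∀ bq ∈ T, (X.filter fun q => dist bq.1 q = 1).card ≤ 11 ∨
        ∃ z₁ ∈ X, ∃ z₂ ∈ X, z₁ ≠ z₂ ∧ dist bq.1 z₁ = 1 ∧ dist bq.1 z₂ = 1 ∧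
          (X.filter fun q => dist z₁ q = 1).card ≤ 11 ∧ (X.filter fun q => dist z₂ q = 1).card ≤ 11) ∧
      (∀ bq ∈ T, ∃ κ, WF r κ ∧
        (((∀ w ∈ fccSlots, bq.2 + F κ w ∈ X) ∧ bq.1 = bq.2 + F κ (u r κ)) ∨
          ∃ m : EuclideanSpace ℝ (Fin 3), ‖m‖ = 1 ∧
            (∀ w ∈ fccSlots, ⟪F κ w, m⟫_ℝ = 0 ∨ ⟪F κ w, m⟫_ℝ = Real.sqrt (2 / 3) ∨ ⟪F κ w, m⟫_ℝ = -Real.sqrt (2 / 3)) ∧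
            (∀ w ∈ fccSlots, ⟪F κ w, m⟫_ℝ ≤ 0 → bq.2 + F κ w ∈ X) ∧
            (∀ w ∈ fccSlots, ⟪F κ w, m⟫_ℝ < 0 → bq.2 + (F κ w - (2 * ⟪F κ w, m⟫_ℝ) • m) ∈ X) ∧
            (∀ w ∈ fccSlots, 0 < ⟪F κ w, m⟫_ℝ → bq.2 + F κ w ∉ X) ∧
            ((⟪F κ (u r κ), m⟫_ℝ = Real.sqrt (2 / 3) ∧ bq.1 = bq.2 - (F κ (u r κ) - (2 * ⟪F κ (u r κ), m⟫_ℝ) • m)) ∨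
              (⟪F κ (u r κ), m⟫_ℝ = 0 ∧ bq.1 = bq.2 + F κ (u r κ))))) := by
    intro r hr
    have hur : ∀ κ, u r κ ∈ fccSlots := word_u_mem (hRT r hr) (hu0 r hr) (huc r hr)
    have hup' : 0 < (F [] (u r [])) 2 := by rw [hu0 r hr]; exact hup r hr
    have hPsrc' : ∀ p ∈ P', P (p + F [] (u r []), []) := by rw [hu0 r hr]; exact hPsrc r hr
    obtain ⟨T, hkey, hT, hpay, -, hwit⟩ := word_family_endPairs_excl (F := F) (u := u r) (WF := WF r) (next := next)
      (t₁ := t₁) (t₂ := t₂) hg hc hX hFc hur (huc r hr) (hWF0 r hr) (hWFc r hr) hnext_pop hnext_push G₂ (hPfull r hr)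
      (hPcross r hr) (hPexcl0 r hr) hup' hR₀ hρ hcell hP₁X hP₂X hP₁ hP' hP'full hPsrc' hP₂
    rw [hu0 r hr] at hkey
    exact ⟨T, by rw [hRIM]; linarith [hkey], hT, hpay, hwit⟩
  choose! Tf hTkey hTpair hTpay hTwit using hfam
  -- pairwise disjointness across roots: LEMMA X
  have hdisj : ∀ r ∈ RT, ∀ r' ∈ RT, r ≠ r' → Disjoint (Tf r) (Tf r') := by
    intro r hr r' hr' hrr'
    rw [Finset.disjoint_left]
    intro bq hbq hbq'
    obtain ⟨κ, hκ, hpat⟩ := hTwit r hr bq hbq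
    obtain ⟨κ', hκ', hpat'⟩ := hTwit r' hr' bq hbq'
    obtain ⟨hlet, hch⟩ := word_letters_of_wf (huc r hr) (hWFc r hr) κ hκ
    obtain ⟨hlet', hch'⟩ := word_letters_of_wf (huc r' hr') (hWFc r' hr') κ' hκ'
    have hne' : r ≠ -r' := by
      intro h
      have h1 := hup r hr
      have h2 := hup r' hr'
      rw [h, map_neg, PiLp.neg_apply] at h1
      linarith
    have hd : F κ (u r κ) = F κ (((-1 : ℝ) ^ κ.length) • r) := by rw [word_u_eq_pow (huc r hr) κ, hu0 r hr]
    have hd' : F κ' (u r' κ') = F κ' (((-1 : ℝ) ^ κ'.length) • r') := by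
      rw [word_u_eq_pow (huc r' hr') κ', hu0 r' hr']
    exact word_target_ne_of_roots_ne hX hFc hlet hlet' hch hch' (hRT r hr) (hRT r' hr') hrr' hne' hd hd' hpat hpat' rfl
  -- the union of the end pairs obeys the family-blind capacity bound
  have hU := card_endPairs_le_payers hX (RT.biUnion Tf) (R₀ := R₀) (h := h)
    (fun bq hbq => by
      obtain ⟨r, hr, hbqr⟩ := mem_biUnion.1 hbq
      exact hTpair r hr bq hbqr)
    (fun bq hbq => by
      obtain ⟨r, hr, hbqr⟩ := mem_biUnion.1 hbq
      exact hTpay r hr bq hbqr)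
  rw [card_biUnion hdisj] at hU
  calc ∑ r ∈ RT, (P'.filter fun p => (∀ w ∈ fccSlots, p + F [] w ∈ X) ∧
          -R₀ - 1 < (p + F [] r) 2 ∧ (p + F [] r) 2 < h + R₀ + 1).card
      ≤ ∑ r ∈ RT, ((Tf r).card + RIM) := sum_le_sum fun r hr => hTkey r hr
    _ = ∑ r ∈ RT, (Tf r).card + RT.card * RIM := by rw [sum_add_distrib, sum_const, smul_eq_mul]
    _ ≤ _ := by rw [hRIM]; linarith [hU]

end Multi

end Summit.Ventures.Crystal3D.Theorems

end
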